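/-
Copyright (c) 2026 the pub-hodgecm-mathlib formalisation cell (harness21).  Prover seat hodgecm-mathlib-F0P2-p11 (g0) (L1; #41 TOP by-value letters `hRKc` of ★ ed. 5∕6a
(KIND W) and of ★ (u-1a)∕v2 p861563∕p861664 (KIND 1)), Track B «K2-LIT» ∕ hLiu418 #184♮, ROAD Φ: THE FOURIER COEFFICIENTS OF THE CONVERGENT EISENSTEIN SERIES ARE
CONTINUOUS IN THE GROUP VARIABLE.  THEOREMS ONLY.
-/
import Summits.HodgeConjecture.HodgeConjecture.Theorems.K2LiuSiegelFourierCoeffDelta               -- ★ Φ1: `fourierCoeffDelta_eq_of_isCoveringWeight` (weight independence)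
import Summits.HodgeConjecture.HodgeConjecture.Theorems.K2LiuSiegelEisensteinContinuous             -- ★ G8 `continuous_eisensteinSeriesDelta`
import Summits.HodgeConjecture.HodgeConjecture.Theorems.K2LiuSiegelEisensteinDoubledLeftInvariant   -- ★ #10b `siegelEisensteinDoubledLeftInvariant`
import Summits.HodgeConjecture.HodgeConjecture.Theorems.K2LiuUnipotentCoveringWeight                -- ★ `exists_isCoveringWeight_unipDeltaRat_lintegral_ne_top`
import Summits.HodgeConjecture.HodgeConjecture.Theorems.K2LiuUnipotentCocompact                     -- ★ (C0) `exists_isCompact_cover_unipDelta`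
import HarnessLib

/-!
# Crux `HLiu418`, ROAD Φ, socket #41: `h ↦ E_S(h; f_s) = fourierCoeffDelta νN β S (E(·; f_s)) h` IS CONTINUOUS ON `H(𝔸)` (`χ` unitary, `Re s > n∕2`, `f_s ∈ I(s, χ)`
# continuous; ANY covering weight `β`, ANY Haar measure `νN`) — the by-value letters `hRKc` of the TOP

Cell `hodgecm-mathlib`, crux item hLiu418 = `stmt-HodgeConjecture-24832` (helper lane, count-neutral); squad K2 ∕ K2Liu, LEAD F0P6-plan (g14), desk = #41 TOP author K2E5-p17 (g8);
prover F0P2-p11 (g0).  THEOREMS ONLY (no `def`, no `instance`, no notation, no named-fact hypothesis, no `sorry`).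

WHY.  ★ #41 TOP edition 5∕6a `K2LiuSiegelEisensteinContinuationTopAssembled.siegelEisensteinContinuation_assembled` carries, for the Whittaker kind, the binder
`(hRKc : ∀ S, det S ≠ 0 → ∀ s, n∕2 < re s → Continuous fun h => fourierCoeffDelta νN β S (eisensteinFamilyDelta f s) h)`, and ★ (u-1a) v2
`K2LiuSiegelEisensteinRankOneTermPackageInstanceWeighted.exists_kindOne_packages_weighted` the rank-one twin (for every Haar `νN` and covering weight `β`): the continuity of
the Fourier coefficients of the CONVERGENT Eisenstein series in the group variable, needed by the Vitali step of every term package.  This file pays both, for all `S` at once: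
* §1 `continuous_integral_wt_smul_conj_mul` ∕ `continuous_fourierCoeffDelta_of_compact_weight` — for ANY continuous `φ : H(𝔸) → ℂ`, a measurable weight `β ≤ 1_K` supported in a
  compact `K ⊆ N_Δ(𝔸)` and a measure finite on compacts, `h ↦ ∫ β(u)·conj ψ_S(u)·φ(u h) dνN(u)` is continuous (Mathlib `continuousAt_of_dominated`: the integrand is continuous in
  `h` and bounded by `1_K·sup_{K·C}|φ|` on a compact neighbourhood `C`; `|ψ_S| = 1`) — the pattern of ★ Φ8 `K2LiuBigCellContinuous` (K2Liu-p13 (g3));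
* §2 `exists_bound_mul_of_unipDeltaRat_invariant` — a continuous `φ` that is left-`N_Δ(L⁺)`-invariant is bounded along every `N_Δ(𝔸)`-orbit (cocompactness ★ (C0));
  **`continuous_fourierCoeffDelta`** — for such `φ`, ANY `N_Δ(L⁺)`-covering weight `β` and any Haar `νN`, `h ↦ fourierCoeffDelta νN β S φ h` is continuous: by ★ Φ1 weight
  independence `fourierCoeffDelta_eq_of_isCoveringWeight` the coefficient equals the one for the compactly supported weight of ★ `exists_isCoveringWeight_unipDeltaRat_lintegral_ne_top`, §1;
* §3 **`continuous_fourierCoeffDelta_eisensteinSeriesDelta`** ∕ **`continuous_fourierCoeffDelta_eisensteinFamilyDelta`** — at `φ := E(·; f_s)` (continuous by ★ G8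
  `continuous_eisensteinSeriesDelta`, left-`H(L⁺)`-invariant by ★ #10b `siegelEisensteinDoubledLeftInvariant`): the TOP's `hRKc` letters (KIND W bytes: `det S ≠ 0` is not used;
  KIND 1 bytes: `∀ νN [IsHaarMeasure] β, IsCoveringWeight β → ∫β ≠ 0 → ∫β ≠ ∞ → ∀ s, n∕2 < re s → Continuous …`, the two integral conditions not used).
References: [MoeglinWaldspurger1995] I.2.6, II.1.5–II.1.7; [Garrett2018] §3.10; [Tan1999] §3; [Folland1995] §2.3.
HONEST LABEL.  Count-neutral helper; `HC_CM` is proved only modulo the 7 printed citations (2 remaining named inputs: hLiu418 = `stmt-HodgeConjecture-24832`,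
h413 = `stmt-HodgeConjecture-24833`) until rung 0 closes.
-/

set_option autoImplicit false
set_option linter.dupNamespace false -- the mandated namespace repeats `HodgeConjecture.HodgeConjecture`

noncomputable section

open scoped Matrix ENNReal NNReal Topology ComplexConjugate
open NumberField IsDedekindDomain MeasureTheory MeasureTheory.Measure Filter Set Function
open Literature.NumberTheory.Automorphic Literature.NumberTheory.Automorphic.UnitaryGroup Literature.NumberTheory.GaloisRepresentations
open Literature.NumberTheory.GelbartRogawski1991 Literature.NumberTheory.GelbartRogawski1991.GRConstruction
open Literature.NumberTheory.K2Lit.SiegelDoubled Literature.MeasureTheory.Group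

namespace Summit.HodgeConjecture.HodgeConjecture.Cruxes.HLiu418.K2LiuFourierCoeffDeltaContinuous

open K2LiuSiegelUnipotentFourierDefs K2LiuSiegelUnipotentCharacters K2LiuUnipotentCoveringWeight K2LiuSiegelFourierCoeffDelta
open K2LiuSiegelEisensteinContinuous (continuous_eisensteinSeriesDelta)
open K2LiuSiegelEisensteinDoubledLeftInvariant (siegelEisensteinDoubledLeftInvariant)
open K2LiuUnipotentCocompact (exists_isCompact_cover_unipDelta)

variable (L : Type) [Field L] [NumberField L] [IsCMField L]
variable {N M n : ℕ} (e : Fin N × Fin M ≃ Fin n)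
  (dV : Fin N → L) (hdV : ∀ i, IsCMField.complexConj L (dV i) = dV i)
  (dW : Fin M → L) (hdW : ∀ i, IsCMField.complexConj L (dW i) = dW i)

/-! ## §1 A compactly supported weight: dominated convergence -/

/-- **`h ↦ ∫ β(u)·(conj ψ_S(u)·φ(u h)) dνN(u)` IS CONTINUOUS** for a continuous `φ : H(𝔸) → ℂ`, a measurable weight `β ≤ 1_K` supported in a compact `K ⊆ N_Δ(𝔸)` and a
measure `νN` finite on compacts (dominated convergence: the integrand is continuous in `h` and bounded by `1_K·sup_{K·C}|φ|` on a compact neighbourhood `C` of `h₀`; `|ψ_S| = 1`).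
[cite: MoeglinWaldspurger1995, II.1.7] [cite: Folland1995, §2.3] -/
theorem continuous_integral_wt_smul_conj_mul
    [MeasurableSpace (unipDelta L e dV hdV dW hdW)] [BorelSpace (unipDelta L e dV hdV dW hdW)]
    (νN : Measure (unipDelta L e dV hdV dW hdW)) [IsFiniteMeasureOnCompacts νN] (S : Matrix (Fin n) (Fin n) L)
    {φ : HA L e dV hdV dW hdW → ℂ} (hφ : Continuous φ)
    {β : unipDelta L e dV hdV dW hdW → ℝ≥0∞} (hβm : Measurable β) {K : Set (unipDelta L e dV hdV dW hdW)} (hK : IsCompact K)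
    (hβK : ∀ u, β u ≤ K.indicator 1 u) :
    Continuous fun h : HA L e dV hdV dW hdW => ∫ u, (β u).toReal •
      (conj (unipDeltaChar L e dV hdV dW hdW S (u : HA L e dV hdV dW hdW) : ℂ) * φ ((u : HA L e dV hdV dW hdW) * h)) ∂νN := by
  -- `β u ≤ 1` everywhere, `β u = 0` off `K`
  have hβle : ∀ u, (β u).toReal ≤ 1 := fun u => by
    have h1 : β u ≤ 1 := (hβK u).trans (Set.indicator_le_self' (fun _ _ => zero_le_one) u)
    simpa using ENNReal.toReal_mono ENNReal.one_ne_top h1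
  have hβ0 : ∀ u, u ∉ K → β u = 0 := fun u hu => by
    have h := hβK u
    rw [Set.indicator_of_notMem hu] at h
    exact le_antisymm h bot_le
  have hψc : Continuous fun u : unipDelta L e dV hdV dW hdW => conj (unipDeltaChar L e dV hdV dW hdW S (u : HA L e dV hdV dW hdW) : ℂ) :=
    Complex.continuous_conj.comp (continuous_unipDeltaChar_coe L e dV hdV dW hdW S)
  refine continuous_iff_continuousAt.2 fun h₀ => ?_
  obtain ⟨C, hCc, hCn⟩ := exists_compact_mem_nhds h₀
  -- a bound of `φ` on the compact `K · C`
  have hD : IsCompact ((fun p : unipDelta L e dV hdV dW hdW × HA L e dV hdV dW hdW => (p.1 : HA L e dV hdV dW hdW) * p.2) '' (K ×ˢ C)) :=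
    (hK.prod hCc).image (continuous_subtype_val.fst'.mul continuous_snd)
  obtain ⟨Mc, hMc⟩ := hD.exists_bound_of_continuousOn hφ.continuousOn
  refine continuousAt_of_dominated (bound := fun u => K.indicator (fun _ => Mc) u) ?_ ?_ ?_ ?_
  · -- measurability, for every `h`
    exact Eventually.of_forall fun h =>
      (hβm.ennreal_toReal.smul (hψc.mul (hφ.comp (continuous_subtype_val.mul continuous_const))).measurable).aestronglyMeasurable
  · -- domination on the neighbourhood `C`
    filter_upwards [hCn] with h hh
    refine Eventually.of_forall fun u => ?_
    by_cases hu : u ∈ K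
    · rw [Set.indicator_of_mem hu, norm_smul, Real.norm_of_nonneg ENNReal.toReal_nonneg, norm_conj_unipDeltaChar_mul]
      calc (β u).toReal * ‖φ ((u : HA L e dV hdV dW hdW) * h)‖ ≤ 1 * Mc :=
            mul_le_mul (hβle u) (hMc _ ⟨(u, h), ⟨hu, hh⟩, rfl⟩) (norm_nonneg _) zero_le_one
        _ = Mc := one_mul _
    · rw [Set.indicator_of_notMem hu, hβ0 u hu, ENNReal.toReal_zero, zero_smul, norm_zero]
  · -- the bound is integrable: a constant on a compact set
    rw [integrable_indicator_iff hK.measurableSet]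
    exact integrableOn_const (hK.measure_lt_top).ne
  · -- continuity of the integrand in `h`
    refine Eventually.of_forall fun u => ?_
    have hu : Continuous fun x : HA L e dV hdV dW hdW =>
        conj (unipDeltaChar L e dV hdV dW hdW S (u : HA L e dV hdV dW hdW) : ℂ) * φ ((u : HA L e dV hdV dW hdW) * x) :=
      continuous_const.mul (hφ.comp (continuous_const.mul continuous_id))
    exact (hu.const_smul ((β u).toReal)).continuousAt

/-- **`h ↦ fourierCoeffDelta νN β S φ h` IS CONTINUOUS FOR A COMPACTLY SUPPORTED WEIGHT** (`φ` continuous, `β ≤ 1_K` measurable, `K` compact, `νN` finite on compacts).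
[cite: MoeglinWaldspurger1995, I.2.6, II.1.7] -/
theorem continuous_fourierCoeffDelta_of_compact_weight
    [MeasurableSpace (unipDelta L e dV hdV dW hdW)] [BorelSpace (unipDelta L e dV hdV dW hdW)]
    (νN : Measure (unipDelta L e dV hdV dW hdW)) [IsFiniteMeasureOnCompacts νN] (S : Matrix (Fin n) (Fin n) L)
    {φ : HA L e dV hdV dW hdW → ℂ} (hφ : Continuous φ)
    {β : unipDelta L e dV hdV dW hdW → ℝ≥0∞} (hβm : Measurable β) {K : Set (unipDelta L e dV hdV dW hdW)} (hK : IsCompact K)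
    (hβK : ∀ u, β u ≤ K.indicator 1 u) :
    Continuous fun h : HA L e dV hdV dW hdW => fourierCoeffDelta L e dV hdV dW hdW νN β S φ h := by
  simp_rw [fourierCoeffDelta_def]
  exact (continuous_integral_wt_smul_conj_mul L e dV hdV dW hdW νN S hφ hβm hK hβK).const_smul (((∫⁻ u, β u ∂νN).toReal⁻¹ : ℝ))

/-! ## §2 Any covering weight: weight independence for left-`N_Δ(L⁺)`-invariant `φ` -/

/-- **a continuous left-`N_Δ(L⁺)`-invariant `φ` is bounded along every `N_Δ(𝔸)`-orbit** (`N_Δ(L⁺)\N_Δ(𝔸)` is compact, ★ (C0) `exists_isCompact_cover_unipDelta`).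
[cite: MoeglinWaldspurger1995, I.2.1, II.1.7] -/
theorem exists_bound_mul_of_unipDeltaRat_invariant (hdV0 : ∀ i, dV i ≠ 0) (hdW0 : ∀ i, dW i ≠ 0)
    {φ : HA L e dV hdV dW hdW → ℂ} (hφc : Continuous φ)
    (hφ : ∀ (γ : unipDeltaRat L e dV hdV dW hdW) (x : HA L e dV hdV dW hdW),
      φ (((γ : unipDelta L e dV hdV dW hdW) : HA L e dV hdV dW hdW) * x) = φ x)
    (h : HA L e dV hdV dW hdW) :
    ∃ C : ℝ, ∀ u : unipDelta L e dV hdV dW hdW, ‖φ ((u : HA L e dV hdV dW hdW) * h)‖ ≤ C := by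
  obtain ⟨K, hK, hcover⟩ := exists_isCompact_cover_unipDelta L e dV hdV dW hdW hdV0 hdW0
  have hD : IsCompact ((fun k : unipDelta L e dV hdV dW hdW => (k : HA L e dV hdV dW hdW) * h) '' K) :=
    hK.image (continuous_subtype_val.mul continuous_const)
  obtain ⟨C, hC⟩ := hD.exists_bound_of_continuousOn hφc.continuousOn
  refine ⟨C, fun u => ?_⟩
  obtain ⟨γ, hγ⟩ := hcover u
  have hγu : φ ((u : HA L e dV hdV dW hdW) * h) = φ (((γ • u : unipDelta L e dV hdV dW hdW) : HA L e dV hdV dW hdW) * h) := by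
    rw [smul_eq_coe_mul, Subgroup.coe_mul, mul_assoc, hφ]
  rw [hγu]
  exact hC _ ⟨γ • u, hγ, rfl⟩

/-- **THE FOURIER COEFFICIENTS OF A CONTINUOUS LEFT-`N_Δ(L⁺)`-INVARIANT `φ` ARE CONTINUOUS IN THE GROUP VARIABLE**, for ANY `N_Δ(L⁺)`-covering weight `β` and any Haar
measure `νN` on `N_Δ(𝔸)`: by ★ Φ1 `fourierCoeffDelta_eq_of_isCoveringWeight` the coefficient equals the one for the compactly supported weight of ★
`exists_isCoveringWeight_unipDeltaRat_lintegral_ne_top` on the cocompact cover ★ (C0), which is continuous by §1. [cite: MoeglinWaldspurger1995, I.2.6, II.1.7] [cite: Tan1999, §3] -/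
theorem continuous_fourierCoeffDelta (hdV0 : ∀ i, dV i ≠ 0) (hdW0 : ∀ i, dW i ≠ 0)
    [MeasurableSpace (unipDelta L e dV hdV dW hdW)] [BorelSpace (unipDelta L e dV hdV dW hdW)]
    (νN : Measure (unipDelta L e dV hdV dW hdW)) [νN.IsHaarMeasure]
    {β : unipDelta L e dV hdV dW hdW → ℝ≥0∞} (hβ : IsCoveringWeight (unipDeltaRat L e dV hdV dW hdW) β) (S : Matrix (Fin n) (Fin n) L)
    {φ : HA L e dV hdV dW hdW → ℂ} (hφc : Continuous φ)
    (hφ : ∀ (γ : unipDeltaRat L e dV hdV dW hdW) (x : HA L e dV hdV dW hdW),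
      φ (((γ : unipDelta L e dV hdV dW hdW) : HA L e dV hdV dW hdW) * x) = φ x) :
    Continuous fun h : HA L e dV hdV dW hdW => fourierCoeffDelta L e dV hdV dW hdW νN β S φ h := by
  obtain ⟨K, hK, hcover⟩ := exists_isCompact_cover_unipDelta L e dV hdV dW hdW hdV0 hdW0
  obtain ⟨β₀, hβ₀, -, hβ₀K, hβ₀top⟩ := exists_isCoveringWeight_unipDeltaRat_lintegral_ne_top L e dV hdV dW hdW νN hK hcover
  have h0 := continuous_fourierCoeffDelta_of_compact_weight L e dV hdV dW hdW νN S hφc hβ₀.measurable hK hβ₀K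
  refine h0.congr fun h => ?_
  exact fourierCoeffDelta_eq_of_isCoveringWeight L e dV hdV dW hdW νN hβ₀ hβ hβ₀top S (hφc.comp (continuous_subtype_val.mul continuous_const))
    (exists_bound_mul_of_unipDeltaRat_invariant L e dV hdV dW hdW hdV0 hdW0 hφc hφ h) fun γ u => by
      rw [Subgroup.coe_mul, mul_assoc, hφ]

/-! ## §3 The Eisenstein series: the TOP's letters `hRKc` -/

/-- **`h ↦ E_S(h; f) = fourierCoeffDelta νN β S (E(·; f)) h` IS CONTINUOUS** (`χ` unitary, `Re s > n∕2`, `f ∈ I(s, χ)` continuous; any covering weight, any Haar `νN`):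
§2 at `φ := E(·; f)` — continuous by ★ G8 `continuous_eisensteinSeriesDelta`, left-`H(L⁺)`-invariant by ★ #10b `siegelEisensteinDoubledLeftInvariant` (`N_Δ(L⁺) = N_Δ(𝔸) ∩ H(L⁺)`).
[cite: MoeglinWaldspurger1995, I.2.6, II.1.5–II.1.7] [cite: Garrett2018, §3.10] -/
theorem continuous_fourierCoeffDelta_eisensteinSeriesDelta (hdV0 : ∀ i, dV i ≠ 0) (hdW0 : ∀ i, dW i ≠ 0)
    [MeasurableSpace (unipDelta L e dV hdV dW hdW)] [BorelSpace (unipDelta L e dV hdV dW hdW)]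
    (νN : Measure (unipDelta L e dV hdV dW hdW)) [νN.IsHaarMeasure]
    {β : unipDelta L e dV hdV dW hdW → ℝ≥0∞} (hβ : IsCoveringWeight (unipDeltaRat L e dV hdV dW hdW) β) (S : Matrix (Fin n) (Fin n) L)
    {χ : HeckeCharacter L} (hχ : χ.IsUnitary) {s : ℂ} (hs : (n : ℝ) / 2 < s.re)
    {f : HA L e dV hdV dW hdW → ℂ} (hf : IsSiegelDeltaSection L e dV hdV dW hdW χ s f) (hfc : Continuous f) :
    Continuous fun h : HA L e dV hdV dW hdW => fourierCoeffDelta L e dV hdV dW hdW νN β S (eisensteinSeriesDelta L e dV hdV dW hdW f) h :=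
  continuous_fourierCoeffDelta L e dV hdV dW hdW hdV0 hdW0 νN hβ S (continuous_eisensteinSeriesDelta L e dV hdV hdV0 dW hdW hdW0 hχ hs hf hfc)
    fun γ x => siegelEisensteinDoubledLeftInvariant L e dV hdV dW hdW χ s f hf
      ⟨((γ : unipDelta L e dV hdV dW hdW) : HA L e dV hdV dW hdW), (mem_unipDeltaRat_iff L e dV hdV dW hdW _).1 γ.2⟩ x

/-- **THE TOP's LETTER `hRKc`, family form, KIND-1 bytes** (★ (u-1a)∕v2 p861563∕p861664): for a family of continuous Siegel sections `f s ∈ I(s, χ)`, `χ` unitary, and any index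
`S`: `∀ νN [IsHaarMeasure] β, IsCoveringWeight β → ∫β ≠ 0 → ∫β ≠ ∞ → ∀ s, n∕2 < re s → Continuous fun h => fourierCoeffDelta νN β S (eisensteinFamilyDelta f s) h` (the two
integral conditions are not used).  The KIND-W letter of ★ ed. 5∕6a is the same at the TOP's fixed `(νN, β)` (its `det S ≠ 0` not used). [cite: MoeglinWaldspurger1995, I.2.6, II.1.7] -/
theorem continuous_fourierCoeffDelta_eisensteinFamilyDelta (hdV0 : ∀ i, dV i ≠ 0) (hdW0 : ∀ i, dW i ≠ 0)
    [MeasurableSpace (unipDelta L e dV hdV dW hdW)] [BorelSpace (unipDelta L e dV hdV dW hdW)]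
    {χ : HeckeCharacter L} (hχ : χ.IsUnitary) {f : ℂ → HA L e dV hdV dW hdW → ℂ}
    (hf : ∀ s, IsSiegelDeltaSection L e dV hdV dW hdW χ s (f s)) (hfc : ∀ s, Continuous (f s)) (S : Matrix (Fin n) (Fin n) L) :
    ∀ (νN : Measure (unipDelta L e dV hdV dW hdW)) [νN.IsHaarMeasure] (β : unipDelta L e dV hdV dW hdW → ℝ≥0∞),
      IsCoveringWeight (unipDeltaRat L e dV hdV dW hdW) β → ∫⁻ u, β u ∂νN ≠ 0 → ∫⁻ u, β u ∂νN ≠ ∞ →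
      ∀ s : ℂ, (n : ℝ) / 2 < s.re →
        Continuous fun h : HA L e dV hdV dW hdW => fourierCoeffDelta L e dV hdV dW hdW νN β S (eisensteinFamilyDelta L e dV hdV dW hdW f s) h :=
  fun νN _ _ hβ _ _ s hs =>
    continuous_fourierCoeffDelta_eisensteinSeriesDelta L e dV hdV dW hdW hdV0 hdW0 νN hβ S hχ hs (hf s) (hfc s)

end Summit.HodgeConjecture.HodgeConjecture.Cruxes.HLiu418.K2LiuFourierCoeffDeltaContinuous

end
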